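/-
Copyright (c) 2026 the pub-hodgecm-mathlib formalisation cell (harness21).  Prover seat hodgecm-mathlib-F0P2-p08 (g3), Track B «K2-LIT»,
#184♮ = hLiu418 = `stmt-HodgeConjecture-24832`; socket #41 `sig_K2LiuSiegelEisensteinContinuation`, KIND W, brick (iii-fin-int): the per-place INTEGRABILITY letter `hint`
of ★ (iii-fin) `K2LiuKindWFiniteLetterDefs.kindWFfin_eq_integral` (T1) (the local factor of ★ (x-a) ED. 4's joint integrability letter), for smooth local Siegel factors.
THEOREMS ONLY (no `def`, no `instance`, no notation, no named-fact hypothesis, no `sorry`).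
-/
import Summits.HodgeConjecture.HodgeConjecture.Theorems.K2LiuGoodPlaceLocalFactorIntegrable   -- ★ `integrable_weylDelta_mul_of_eq` (★ V1c on any subgroup with the carrier of `N_Δ(L⁺_v)`), ★ B4, ★ B1
import Summits.HodgeConjecture.HodgeConjecture.Theorems.K2LiuSiegelEisensteinKindWLetters      -- ★ (x-a) ED. 1–2: `kindWFinset` (the dependent place type of `FvT`)
import Summits.HodgeConjecture.HodgeConjecture.Theorems.K2LiuSiegelUnipotentCharacters         -- ★ `continuous_unipDeltaChar`
import HarnessLib

/-!
# Crux `HLiu418`, socket #41, KIND W — brick (iii-fin-int) `K2LiuKindWFiniteLetterIntegrable`: THE PER-PLACE INTEGRABILITY LETTER `hint` ON `{1 < re s}`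
# `y ↦ conj ψ_S(ι_v y) · F_v(s)((w_Δ)_v · y · h_v)` is `ν_v`-integrable on `N_Δ(L⁺_v)` for a SMOOTH LOCAL SIEGEL SECTION `F_v(s) ∈ I_v(s, χ_v)`, `χ` unitary

Cell `hodgecm-mathlib`, crux item hLiu418 = `stmt-HodgeConjecture-24832` (helper lane `--supports … --as helper`, count-neutral), route of record
`HCCMUnconditional`; squad K2 ∕ K2Liu, road `K2_Liu`, socket #41, KIND W; KW desk of record F0P2-p08 (g3).  THE LETTER PAID: the binder `hint` of ★ p863154 (iii-fin)
`K2LiuKindWFiniteLetterDefs.kindWFfin_eq_integral` (T1) — per term `j`, per non-singular skew index `S`, per `h`, per place `v ∈ kindWFinset T₀ ↑S h`, on `{n∕2 < re s}`: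
`Integrable (y ↦ conj ψ_S(ι_v y) · FvT j S h v s ((w_Δ)_v · y · h_v)) (νv v)` — for local factors `FvT j S h v s` that are SMOOTH LOCAL SIEGEL SECTIONS of `I_v(s, χ_v)` (★
`LocalSiegelDoubled.IsLocalSiegelSection` + `IsSmooth`, hypothesis-first: the (KW-fac) decomposition of a standard `K`-finite family supplies exactly such factors) and `χ`
unitary.  It is ★ V1c `K2LiuSiegelIntertwiningIntegrable.integrable_weylDelta_mul` (`u ↦ f₀(w_Δ u h)` integrable on `N_Δ(L⁺_v)` for `1 < re s`, smooth Siegel `f₀`, unitary `χ_v`)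
through ★ `K2LiuGoodPlaceLocalFactorIntegrable.integrable_weylDelta_mul_of_eq` (any subgroup with the carrier of `N_Δ`, ★ B1 `unipDeltaLoc_eq_unipDeltaLocal`), ★ B4
`evalPlace_finPart_weylDelta` (`(w_Δ)_v` = ★ D10's local `w_Δ`), times the unit-modulus continuous character (`Integrable.bdd_mul`, ★ `continuous_unipDeltaChar`, ★
`UnitaryGroup.continuous_inclPlaceAdelic`, `Circle.norm_coe`) — the twin of ★ `integrable_skew_lambdaLoc` WITHOUT the Skew transport and for a general section.
* §1 **`integrable_conj_unipDeltaChar_mul_of_isLocalSiegelSection`** — one place `v`, one smooth local Siegel section `f₀`, `1 < re s`, any `h_v`.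
* §2 **`hint_of_isLocalSiegelSection`** — ★ (T1)'s binder `hint` VERBATIM at `n := 2` (datum `e : Fin N × Fin M ≃ Fin 2`; `2∕2 < re s`), from `hχu` and the per-factor letters
  `hsec`, `hsm` (guarded by the same half-plane).
[KudlaSweet1997, §1] [Casselman1980, §3] [KudlaRallis1994, §1–§2] [Weil1965, §37].
HONEST LABEL.  Count-neutral helper; closes no socket by itself: `HC_CM` is proved only modulo the 7 printed citations (2 remaining named inputs:
hLiu418 = `stmt-HodgeConjecture-24832`, h413 = `stmt-HodgeConjecture-24833`) until rung 0 closes.  NOT HERE (by value): that the (KW-fac) local factors ARE smooth Siegel sections.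

## References
* [KudlaSweet1997] S. Kudla, W. J. Sweet, *Degenerate principal series representations for U(n,n)*, Israel J. Math. 98 (1997): §1.
* [Casselman1980] W. Casselman, Compositio Math. 40 (1980): §3.   * [KudlaRallis1994] S. Kudla, S. Rallis, Ann. of Math. 140 (1994): §1–§2.
* [Weil1965] A. Weil, *L'intégration dans les groupes topologiques* (1965): §37.
-/

set_option autoImplicit false
-- the mandated namespace repeats the single-problem summit's segment (`HodgeConjecture.HodgeConjecture`)
set_option linter.dupNamespace false

noncomputable section

open scoped Matrix ComplexConjugate NNReal ENNReal
open NumberField IsDedekindDomain Matrix MeasureTheory Measure Set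
open Literature.NumberTheory.Automorphic Literature.NumberTheory.Automorphic.UnitaryGroup Literature.NumberTheory.GaloisRepresentations
open Literature.NumberTheory.LFunctions
open Literature.NumberTheory.GelbartRogawski1991 Literature.NumberTheory.GelbartRogawski1991.GRConstruction
open Literature.NumberTheory.GelbartRogawski1991.UnitaryDualPair
open Literature.NumberTheory.K2Lit Literature.NumberTheory.K2Lit.SiegelDoubled Literature.NumberTheory.K2Lit.LocalSiegelDoubled Literature.NumberTheory.K2Lit.PlaceSplitting
open Summit.HodgeConjecture.HodgeConjecture.Cruxes.HLiu418.K2LiuSiegelUnipotentFourierDefs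
open Summit.HodgeConjecture.HodgeConjecture.Cruxes.HLiu418.K2LiuSiegelUnipotentLocalDefs
open Summit.HodgeConjecture.HodgeConjecture.Cruxes.HLiu418.K2LiuSiegelUnipotentCharacters (continuous_unipDeltaChar)
open Summit.HodgeConjecture.HodgeConjecture.Cruxes.HLiu418.K2LiuUnipDeltaLocBridge
open Summit.HodgeConjecture.HodgeConjecture.Cruxes.HLiu418.K2LiuLocalWhittakerFactorSkew (evalPlace_finPart_weylDelta)
open Summit.HodgeConjecture.HodgeConjecture.Cruxes.HLiu418.K2LiuGoodPlaceLocalFactorIntegrable (integrable_weylDelta_mul_of_eq)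
open Summit.HodgeConjecture.HodgeConjecture.Cruxes.HLiu418.K2LiuSiegelEisensteinKindWLetters

namespace Summit.HodgeConjecture.HodgeConjecture.Cruxes.HLiu418.K2LiuKindWFiniteLetterIntegrable

variable (L : Type) [Field L] [NumberField L] [IsCMField L]
variable {N M : ℕ} (e : Fin N × Fin M ≃ Fin 2)
  (dV : Fin N → L) (hdV : ∀ i, IsCMField.complexConj L (dV i) = dV i)
  (dW : Fin M → L) (hdW : ∀ i, IsCMField.complexConj L (dW i) = dW i)
  (hdV0 : ∀ i, dV i ≠ 0) (hdW0 : ∀ i, dW i ≠ 0)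

/-! ## §1 One place, one smooth local Siegel section -/

section One

variable (v : HeightOneSpectrum (𝓞 (Fp L))) [MeasurableSpace ↥(unipDeltaLoc L e dV hdV dW hdW v)] [BorelSpace ↥(unipDeltaLoc L e dV hdV dW hdW v)]

include hdV0 hdW0 in
set_option maxHeartbeats 800000 in -- MEASURED: 400 000 ✗ (`whnf` of the statement ∕ ★ V1c's application in the K2Lit datum's binder telescope) ∕ 800 000 ✓ — ★ `integrable_lambdaLoc_weylDelta`'s class; scoped 4×, plain `rw`∕`exact`
/-- **`y ↦ conj ψ_S(ι_v y) · f₀((w_Δ)_v · y · h_v)` IS INTEGRABLE ON `N_Δ(L⁺_v)`** for `1 < re s`, `χ` unitary, and a SMOOTH LOCAL SIEGEL SECTION `f₀ ∈ I_v(s, χ_v)` — ★ V1c through ★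
`integrable_weylDelta_mul_of_eq` at ★ B1 `unipDeltaLoc_eq_unipDeltaLocal`, ★ B4 `evalPlace_finPart_weylDelta`, times the unit-modulus continuous character.
[cite: KudlaSweet1997, §1] [cite: Casselman1980, §3] [cite: Weil1965, §37] -/
theorem integrable_conj_unipDeltaChar_mul_of_isLocalSiegelSection (ν : Measure ↥(unipDeltaLoc L e dV hdV dW hdW v)) [ν.IsHaarMeasure]
    {χ : HeckeCharacter L} (hχu : χ.IsUnitary) {s : ℂ} (hs : 1 < s.re)
    {f₀ : UnitaryGroup.localPi L (IsCMField.complexConj L) (2 + 2) (hermD L e dV hdV dW hdW) v → ℂ}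
    (hsec : haveI : Algebra.IsQuadraticExtension (Fp L) L := IsCMField.isQuadraticExtension L
      IsLocalSiegelSection (Fp L) L (IsCMField.complexConj L) (complexConj_imagUnit L) (imagUnit_ne_zero L) (imagUnit_mul_self L) v 2
        (gramR_isSymm L e dV hdV dW hdW) (hermD_eq_map_gramD L e dV hdV dW hdW) (fun w => χ.localComponent w.1) s f₀)
    (hsm : IsSmooth (Fp L) L (IsCMField.complexConj L) v 2 (JD := hermD L e dV hdV dW hdW) f₀)
    (S : Matrix (Fin 2) (Fin 2) L) (hv : UnitaryGroup.localPi L (IsCMField.complexConj L) (2 + 2) (hermD L e dV hdV dW hdW) v) :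
    Integrable (fun y : ↥(unipDeltaLoc L e dV hdV dW hdW v) =>
      conj (unipDeltaChar L e dV hdV dW hdW S
          (locToAdelic L e dV hdV dW hdW v (y : UnitaryGroup.localPi L (IsCMField.complexConj L) (2 + 2) (hermD L e dV hdV dW hdW) v)) : ℂ) *
        f₀ (UnitaryGroup.evalPlace (Fp L) L (IsCMField.complexConj L) (2 + 2) (hermD L e dV hdV dW hdW) v
              (UnitaryGroup.finPart (Fp L) L (IsCMField.complexConj L) (2 + 2) (hermD L e dV hdV dW hdW) (SiegelDoubled.weylDelta L e dV hdV dW hdW)) *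
            (y : UnitaryGroup.localPi L (IsCMField.complexConj L) (2 + 2) (hermD L e dV hdV dW hdW) v) * hv)) ν := by
  haveI : Algebra.IsQuadraticExtension (Fp L) L := IsCMField.isQuadraticExtension L
  have hχ1 : ∀ (w : UnitaryGroup.PlacesOver L v) (x : (w.1.adicCompletion L)ˣ), ‖((χ.localComponent w.1 x : ℂˣ) : ℂ)‖ = 1 := fun w x => by
    rw [HeckeCharacter.localComponent_apply]
    exact hχu _
  -- ★ V1c on `unipDeltaLoc v` (★ B1), at ★ D10's local `w_Δ` (★ B4)
  have hI := integrable_weylDelta_mul_of_eq (Fp L) L (IsCMField.complexConj L) (complexConj_imagUnit L) (imagUnit_ne_zero L) (imagUnit_mul_self L) v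
    (gramR_isSymm L e dV hdV dW hdW) (hermD_eq_map_gramD L e dV hdV dW hdW)
    (isUnit_det_gram (Fp L) e (isUnit_det_realDiagonal L dV hdV hdV0) (isUnit_det_realDiagonal L dW hdW hdW0)) (unipDeltaLoc_eq_unipDeltaLocal L e dV hdV dW hdW v) ν hχ1 hs
    hsec hsm hv
  rw [evalPlace_finPart_weylDelta]
  -- the unit-modulus continuous character
  refine hI.bdd_mul (c := 1) ?_ (Filter.Eventually.of_forall fun y => ?_)
  · refine Continuous.aestronglyMeasurable ?_
    exact Complex.continuous_conj.comp ((continuous_unipDeltaChar L e dV hdV dW hdW S).comp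
      ((UnitaryGroup.continuous_inclPlaceAdelic (Fp L) L (IsCMField.complexConj L) (2 + 2) (hermD L e dV hdV dW hdW) v).comp continuous_subtype_val))
  · rw [Complex.norm_conj]
    exact (Circle.norm_coe _).le

end One

/-! ## §2 The letter `hint` of ★ (iii-fin) `kindWFfin_eq_integral`, verbatim -/

section Head

variable [∀ v : HeightOneSpectrum (𝓞 (Fp L)), MeasurableSpace ↥(unipDeltaLoc L e dV hdV dW hdW v)]
  [∀ v : HeightOneSpectrum (𝓞 (Fp L)), BorelSpace ↥(unipDeltaLoc L e dV hdV dW hdW v)]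

include hdV0 hdW0 in
/-- **THE LETTER `hint` OF ★ (iii-fin) `kindWFfin_eq_integral` (T1) AT `n := 2`, PAID FOR SMOOTH LOCAL SIEGEL FACTORS.**  Inputs: carriers `νv` (Haar), `χ` unitary (`hχu`; at the TOP
★ `isUnitary_toHeckeCharacter`), the local factors `FvT j S h v s` of the Σ⊗ presentation (by value, (KW-fac)) with the per-factor letters — on `{2∕2 < re s}`, `det ↑S ≠ 0` —
`hsec` (each is a local Siegel section of `I_v(s, χ_v)`, ★ `IsLocalSiegelSection`) and `hsm` (smooth, ★ `IsSmooth`).  THEN ★ (T1)'s `hint` VERBATIM (§1 at each `(j,S,h,v,s)`).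
[cite: KudlaSweet1997, §1] [cite: Casselman1980, §3] [cite: KudlaRallis1994, §2] -/
theorem hint_of_isLocalSiegelSection (T₀ : Finset (HeightOneSpectrum (𝓞 (Fp L))))
    (νv : ∀ v : HeightOneSpectrum (𝓞 (Fp L)), Measure ↥(unipDeltaLoc L e dV hdV dW hdW v)) [∀ v, (νv v).IsHaarMeasure]
    {χ : HeckeCharacter L} (hχu : χ.IsUnitary) {m : ℕ}
    (FvT : Fin m → ∀ (S : skewMatrices ((IsCMField.complexConj L : L ≃ₐ[Fp L] L) : L →+* L) ((gramR L e dV hdV dW hdW).map (algebraMap (Fp L) L)))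
      (h : HA L e dV hdV dW hdW) (v : (kindWFinset L e dV hdV dW hdW T₀ (S : Matrix (Fin 2) (Fin 2) L) h)),
      ℂ → UnitaryGroup.localPi L (IsCMField.complexConj L) (2 + 2) (hermD L e dV hdV dW hdW) v.1 → ℂ)
    (hsec : haveI : Algebra.IsQuadraticExtension (Fp L) L := IsCMField.isQuadraticExtension L
      ∀ (j : Fin m) (S : skewMatrices ((IsCMField.complexConj L : L ≃ₐ[Fp L] L) : L →+* L) ((gramR L e dV hdV dW hdW).map (algebraMap (Fp L) L)))
      (h : HA L e dV hdV dW hdW) (v : (kindWFinset L e dV hdV dW hdW T₀ (S : Matrix (Fin 2) (Fin 2) L) h)) (s : ℂ), ((2 : ℕ) : ℝ) / 2 < s.re → (S : Matrix (Fin 2) (Fin 2) L).det ≠ 0 →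
      IsLocalSiegelSection (Fp L) L (IsCMField.complexConj L) (complexConj_imagUnit L) (imagUnit_ne_zero L) (imagUnit_mul_self L) v.1 2
        (gramR_isSymm L e dV hdV dW hdW) (hermD_eq_map_gramD L e dV hdV dW hdW) (fun w => χ.localComponent w.1) s (FvT j S h v s))
    (hsm : ∀ (j : Fin m) (S : skewMatrices ((IsCMField.complexConj L : L ≃ₐ[Fp L] L) : L →+* L) ((gramR L e dV hdV dW hdW).map (algebraMap (Fp L) L)))
      (h : HA L e dV hdV dW hdW) (v : (kindWFinset L e dV hdV dW hdW T₀ (S : Matrix (Fin 2) (Fin 2) L) h)) (s : ℂ), ((2 : ℕ) : ℝ) / 2 < s.re → (S : Matrix (Fin 2) (Fin 2) L).det ≠ 0 →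
      IsSmooth (Fp L) L (IsCMField.complexConj L) v.1 2 (JD := hermD L e dV hdV dW hdW) (FvT j S h v s)) :
    ∀ (j : Fin m) (S : skewMatrices ((IsCMField.complexConj L : L ≃ₐ[Fp L] L) : L →+* L) ((gramR L e dV hdV dW hdW).map (algebraMap (Fp L) L)))
      (h : HA L e dV hdV dW hdW) (v : (kindWFinset L e dV hdV dW hdW T₀ (S : Matrix (Fin 2) (Fin 2) L) h)) (s : ℂ), ((2 : ℕ) : ℝ) / 2 < s.re → (S : Matrix (Fin 2) (Fin 2) L).det ≠ 0 →
      Integrable (fun y : ↥(unipDeltaLoc L e dV hdV dW hdW v.1) =>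
        conj (unipDeltaChar L e dV hdV dW hdW (S : Matrix (Fin 2) (Fin 2) L)
            (locToAdelic L e dV hdV dW hdW v.1
              ((y : ↥(unipDeltaLoc L e dV hdV dW hdW v.1)) : UnitaryGroup.localPi L (IsCMField.complexConj L) (2 + 2) (hermD L e dV hdV dW hdW) v.1)) : ℂ) *
          FvT j S h v s (UnitaryGroup.evalPlace (Fp L) L (IsCMField.complexConj L) (2 + 2) (hermD L e dV hdV dW hdW) v.1
                (UnitaryGroup.finPart (Fp L) L (IsCMField.complexConj L) (2 + 2) (hermD L e dV hdV dW hdW) (SiegelDoubled.weylDelta L e dV hdV dW hdW)) *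
              ((y : ↥(unipDeltaLoc L e dV hdV dW hdW v.1)) : UnitaryGroup.localPi L (IsCMField.complexConj L) (2 + 2) (hermD L e dV hdV dW hdW) v.1) *
              UnitaryGroup.evalPlace (Fp L) L (IsCMField.complexConj L) (2 + 2) (hermD L e dV hdV dW hdW) v.1
                (UnitaryGroup.finPart (Fp L) L (IsCMField.complexConj L) (2 + 2) (hermD L e dV hdV dW hdW) h))) (νv v.1) := by
  intro j S h v s hs hdet
  have hs' : 1 < s.re := by norm_num at hs; exact hs
  exact integrable_conj_unipDeltaChar_mul_of_isLocalSiegelSection L e dV hdV dW hdW hdV0 hdW0 v.1 (νv v.1) hχu hs' (hsec j S h v s hs hdet) (hsm j S h v s hs hdet)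
    (S : Matrix (Fin 2) (Fin 2) L) _

end Head

end Summit.HodgeConjecture.HodgeConjecture.Cruxes.HLiu418.K2LiuKindWFiniteLetterIntegrable

end
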